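import Summits.ABC.IUTFork.LDHGenuinePerImageShellDatum
import HarnessLib

/-!
# The fork at [IUTchIII] Corollary 3.12, L-DH level, READING (P): the hypothesis-free rational-point sufficiency with the WILD
# LOG-SHELL term (abc-iut cell, crux ThetaPartII = stmt-ABC-19678; row «C:PERIMAGE-SHELL», part 3)

Record-only PROOF file (D-0012) of the abc-iut cell (WAVE-3 discharge seat abc-iut-c312-d1, gen 9). TAKES NO SIDE on [IUTchIII]
Cor. 3.12. With part 1 (`LDHGenuinePerImageSufficiencyShell`: the per-image `−|log(Θ)|` pays the log-shell eccentricity), part 2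
(`LDHGenuinePerImageShellDatum`: datum form; `l·lcm(30/gcd(30,e_p), c_p) ∣ e(W ∣ p)` at every place over a pole `p ∉ {2,l}`) and
`TensorPacketContentShell.exists_shellPair_ge_of_forall_ne` (off the cyclotomic indices the shell pair pays `(a − p^a/e + 1/e)·log p`):

* **`Cor22.cor312PerImageOf_ratPoint_shell`** — for `q ∈ ℚ ∖ {0, 1}` with `j(q) = N/∏_{p∈I} p^{e_p}`, a prime `l ≥ 7`, a set
  `Psh ⊆ I` of poles with `p ≠ 2`, `p ≠ l`, `l ∤ p − 1`, and exponents `a_p : ℕ`: writing `m_p := l·lcm(30/gcd(30,e_p), c_p)`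
  (`c_3 = 2`, `c_5 = 4`, else `1`), if
  `κ_l·log q^{∤2l}(q) ≤ ((l+5)/4 − 1)·( Σ_{p∈I, p≠2, p≠l} (1 − 1/m_p)·log p + ½·log 2 + [3∉I]·½·log 3 + [5∉I]·¾·log 5 + (1 − 1/(l−1))·log l )
     + ((l+5)/4)·Σ_{p∈Psh} (a_p − p^{a_p}/m_p)·log p + ((l+5)/4)·log π`
  then `T.Cor312PerImageOf` — [IUTchIII] Cor. 3.12 in the cell's READING (P), AS TYPED — at EVERY genuine Θ-volume datum `T` of `(q, l)`.
  At a pole `p ∈ Psh` every completion `K_{u̲}` has `e ≥ m_p` with `l ∣ e`, so `e` is not a cyclotomic index (`l ≠ p`, `l ∤ p − 1`) and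
  `S_p := (a_p − p^{a_p}/m_p)·log p ≤ (a_p − p^{a_p}/e + 1/e)·log p` is an admissible shell function; `Psh ⊆ T(I)` because `e ≥ m_p > 1`
  forces `p ∣ disc K`.

READING (desk note; numbers about OUR typed objects): with `a_p` the turning exponent of `m_p` the shell term adds
`((l+5)/(l+1))·(a_p − p^{a_p}/m_p)·log p` nats of margin per pole, and on the desk EVERY Szpiro-bad (triple, l) pair of the cell's N3 scan
(2,158 pairs, `l ≥ 7`; in particular all 87 TARGET pairs) passes with margin `≥ 7.3` nats; row files follow. HONEST SCOPE: the (Ind2) of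
reading (P) is the tree's FULL lattice-automorphism group `Aut_{ℚ_p}(V : log_p(R_I^×))` (Dupuy–Hilado §4.9); at wildly ramified completions
this group moves a Θ-box onto the long vectors of the log-shell lattice, which is what the shell term measures; nothing here bears on print's
(Ind2) or on the printed inequality, asserts the existence of Θ-data, Cor. 3.12 in general, or abc; proved-as-typed ≠ in print.
[cite: Mochizuki2012, IUTchI Def. 3.1 (a)(b)(c) p. 61–62; IUTchIII Cor. 3.12 p. 173–174, proof Step (x) p. 181; IUTchIV Prop. 1.2 (i)(ii) p. 10,
Thm. 1.10 Step (ii) p. 24, Step (v) p. 27–29] [cite: DupuyHilado2025, §4.9, §4.12] [cite: NeukirchANT1999, Ch. II (5.5), (6.8)]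
[claim: Mochizuki2012, status: disputed] for every IUT quotation. PROOF-ONLY: no definitions, no new `Prop`.
-/

noncomputable section

open NumberField IsDedekindDomain Ideal Module

namespace Literature.IUT.LogVolume.Cor22

open Literature.NumberTheory.DiophantineGeometry.GenEll Summit.ABC.IUTFork Literature.IUT.HodgeTheaters
open Literature.NumberTheory.NumberFields Literature.NumberTheory.GaloisRepresentations.Ultrametric
open Literature.NumberTheory.DiophantineGeometry.UniformABCConjecture Rat.HeightOneSpectrum

variable {q : ℚ} {l : ℕ} {N D : ℕ} {I : Finset ℕ} {e : ℕ → ℕ}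

/-- **RATIONAL POINTS, UNCONDITIONAL FORM WITH THE WILD LOG-SHELL TERM** (see the module docstring for the statement in words).
[cite: Mochizuki2012, IUTchIII Cor. 3.12 p. 173–174, proof Step (x) p. 181] [cite: Mochizuki2012, IUTchIV Prop. 1.2 (i)(ii) p. 10, Thm. 1.10
Step (ii) p. 24, Step (v) p. 27–29] [cite: DupuyHilado2025, §4.9, §4.12] [claim: Mochizuki2012, status: disputed] -/
theorem cor312PerImageOf_ratPoint_shell (hq0 : q ≠ 0) (hq1 : q ≠ 1) (hl : l.Prime) (h7 : 7 ≤ l)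
    (hI : ∀ p ∈ I, p.Prime) (he : ∀ p ∈ I, e p ≠ 0) (hD : D = ∏ p ∈ I, p ^ e p)
    (hj : jInv q = (N : ℚ) / (D : ℚ)) (hN : N ≠ 0) (hcop : ∀ p ∈ I, ¬ p ∣ N)
    (Psh : Finset ℕ) (a : ℕ → ℕ) (hPshI : Psh ⊆ I) (hPsh : ∀ p ∈ Psh, p ≠ 2 ∧ p ≠ l ∧ ¬ l ∣ p - 1)
    (h : (((l : ℝ) + 1) / 24 - 1 / (2 * l)) * logQAvoid (ratPoint q) {2, l} ≤
      (((l : ℝ) + 5) / 4 - 1) *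
          ((∑ p ∈ I.filter (fun p => p ≠ 2 ∧ p ≠ l),
              (1 - ((l * Nat.lcm (30 / Nat.gcd 30 (e p)) (if p = 3 then 2 else if p = 5 then 4 else 1) : ℕ) : ℝ)⁻¹)
                * Real.log p)
            + 2⁻¹ * Real.log 2
            + (if 3 ∈ I then 0 else 2⁻¹ * Real.log 3)
            + (if 5 ∈ I then 0 else (3 / 4 : ℝ) * Real.log 5)
            + (1 - ((l - 1 : ℕ) : ℝ)⁻¹) * Real.log l)
        + ((l : ℝ) + 5) / 4 * ∑ p ∈ Psh,
            (((a p : ℕ) : ℝ) - (p : ℝ) ^ (a p) /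
                ((l * Nat.lcm (30 / Nat.gcd 30 (e p)) (if p = 3 then 2 else if p = 5 then 4 else 1) : ℕ) : ℝ)) * Real.log p
        + ((l : ℝ) + 5) / 4 * Real.log Real.pi)
    (T : ThetaVolumeDatumAt (ratPoint q) l) : T.Cor312PerImageOf := by
  classical
  letI := T.instFieldF; letI := T.instNumberFieldF; letI := T.instAlgebraF; letI := T.instFieldK
  letI := T.instNumberFieldK; letI := T.instAlgebraK
  letI : Algebra (ratPoint q).F T.K := ((algebraMap T.F T.K).comp (algebraMap (ratPoint q).F T.F)).toAlgebra
  have hUP := ratPoint_mem_UPle_one hq0 hq1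
  have hd1 : dmod (ratPoint q) = 1 := dmod_eq_one_of_degree_le_one (le_of_eq (degree_ratPoint _))
  have hl2 : l ≠ 2 := by omega
  have hl3 : l ≠ 3 := by omega
  have hl5 : l ≠ 5 := by omega
  -- the primes carrying a weight, and the weights
  obtain ⟨Ps, hPs⟩ : ∃ Ps : Finset ℕ, Ps = I.filter (fun p => p ≠ 2 ∧ p ≠ l) ∪ ({2, l} ∪ ({3, 5} \ I)) := ⟨_, rfl⟩
  have hPs_prime : ∀ p ∈ Ps, p.Prime := by
    intro p hp
    rw [hPs] at hp
    rcases Finset.mem_union.mp hp with h | h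
    · exact hI p (Finset.mem_filter.mp h).1
    · rcases Finset.mem_union.mp h with h | h
      · rcases Finset.mem_insert.mp h with rfl | h
        · exact Nat.prime_two
        · rw [Finset.mem_singleton] at h; subst h; exact hl
      · have h35 := (Finset.mem_sdiff.mp h).1
        rcases Finset.mem_insert.mp h35 with rfl | h35
        · norm_num
        · rw [Finset.mem_singleton] at h35; subst h35; norm_num
  obtain ⟨m', hm'⟩ : ∃ m' : ℕ → ℕ, m' = fun p =>
      if p ∈ I ∧ (p ≠ 2 ∧ p ≠ l) then l * Nat.lcm (30 / Nat.gcd 30 (e p)) (if p = 3 then 2 else if p = 5 then 4 else 1)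
      else if p = l then l - 1 else if p = 5 then 4 else 2 := ⟨_, rfl⟩
  have hcpos : ∀ p, 0 < (if p = 3 then 2 else if p = 5 then 4 else 1 : ℕ) := by
    intro p; split_ifs <;> norm_num
  have hrpos : ∀ p, 0 < 30 / Nat.gcd 30 (e p) := fun p =>
    Nat.div_pos (Nat.gcd_le_left _ (by norm_num)) (Nat.gcd_pos_of_pos_left _ (by norm_num))
  have hlcmpos : ∀ p, 0 < Nat.lcm (30 / Nat.gcd 30 (e p)) (if p = 3 then 2 else if p = 5 then 4 else 1) :=
    fun p => Nat.lcm_pos (hrpos p) (hcpos p)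
  -- values of the weights
  have hmA : ∀ p ∈ I.filter (fun p => p ≠ 2 ∧ p ≠ l),
      m' p = l * Nat.lcm (30 / Nat.gcd 30 (e p)) (if p = 3 then 2 else if p = 5 then 4 else 1) := by
    intro p hp
    obtain ⟨hpI, hp2l⟩ := Finset.mem_filter.mp hp
    simp only [hm', if_pos (And.intro hpI hp2l)]
  have hm2 : m' 2 = 2 := by simp [hm', Ne.symm hl2]
  have hml : m' l = l - 1 := by simp [hm']
  have hm3 : 3 ∉ I → m' 3 = 2 := fun h3 => by simp [hm', h3, Ne.symm hl3]
  have hm5 : 5 ∉ I → m' 5 = 4 := fun h5 => by simp [hm', h5, Ne.symm hl5]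
  have hm'pos : ∀ p, 0 < m' p := by
    intro p
    by_cases hA : p ∈ I ∧ (p ≠ 2 ∧ p ≠ l)
    · have hv : m' p = l * Nat.lcm (30 / Nat.gcd 30 (e p)) (if p = 3 then 2 else if p = 5 then 4 else 1) := by
        simp only [hm', if_pos hA]
      rw [hv]; exact Nat.mul_pos hl.pos (hlcmpos p)
    · by_cases hpl : p = l
      · have hv : m' p = l - 1 := by simp only [hm', if_neg hA, if_pos hpl]
        rw [hv]; omega
      · by_cases hp5 : p = 5
        · have hv : m' p = 4 := by simp only [hm', if_neg hA, if_neg hpl, if_pos hp5]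
          rw [hv]; norm_num
        · have hv : m' p = 2 := by simp only [hm', if_neg hA, if_neg hpl, if_neg hp5]
          rw [hv]; norm_num
  -- the places of `F_tpd = ℚ` over `Ps`, and their weights
  obtain ⟨f, hf⟩ : ∃ f : {p // p ∈ Ps} → HeightOneSpectrum (𝓞 ℚ),
      f = fun pp => (primesEquiv (R := 𝓞 ℚ)).symm ⟨pp.1, hPs_prime pp.1 pp.2⟩ := ⟨_, rfl⟩
  have hgen : ∀ pp : {p // p ∈ Ps}, natGenerator (f pp) = pp.1 := fun pp => by
    rw [hf]; exact congrArg Subtype.val ((primesEquiv (R := 𝓞 ℚ)).apply_symm_apply ⟨pp.1, hPs_prime pp.1 pp.2⟩)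
  have hfinj : Function.Injective f := by
    intro a b hab
    have h := congrArg (fun v => natGenerator (R := 𝓞 ℚ) v) hab
    simp only [hgen] at h
    exact Subtype.ext h
  have hmemf : ∀ pp : {p // p ∈ Ps}, ((pp.1 : ℕ) : 𝓞 ℚ) ∈ (f pp).asIdeal := fun pp =>
    (natCast_mem_asIdeal_iff (f pp) pp.1).2 (by rw [hgen pp])
  obtain ⟨S, hS⟩ : ∃ S : Finset (HeightOneSpectrum (𝓞 ℚ)), S = Ps.attach.image f := ⟨_, rfl⟩
  obtain ⟨m, hm⟩ : ∃ m : HeightOneSpectrum (𝓞 ℚ) → ℕ, m = fun v => m' (natGenerator v) := ⟨_, rfl⟩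
  have hmS : ∀ v ∈ S, 0 < m v := fun v _ => by rw [hm]; exact hm'pos _
  -- the ramification hypothesis (stated over the point's `F_tpd`): every weight divides `e(w ∣ v)`
  have hram : ∀ v : HeightOneSpectrum (𝓞 (ratPoint q).F), v ∈ S →
      ∀ w ∈ IsDedekindDomain.primesOverFinset v.asIdeal (𝓞 T.K), m v ≤ ramificationIdx' v.asIdeal w := by
    intro v hv w hw
    rw [hS] at hv
    obtain ⟨pp, -, rfl⟩ := Finset.mem_image.mp hv
    obtain ⟨p, hp⟩ := pp
    have hmv : m (f ⟨p, hp⟩) = m' p := by simp only [hm, hgen]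
    rw [hmv]
    refine ThetaVolumeDatumAt.le_ramificationIdx'_of_dvd T (f ⟨p, hp⟩) hw ?_
    have hmem : ((p : ℕ) : 𝓞 (ratPoint q).F) ∈ (f ⟨p, hp⟩).asIdeal := hmemf ⟨p, hp⟩
    have hp' := hp
    rw [hPs] at hp'
    rcases Finset.mem_union.mp hp' with hpA | hpBC
    · -- a bad prime `p ≠ 2, l`: weight `l·lcm(30/gcd(30,e_p), c_p)`
      obtain ⟨hpI, hp2, hpl⟩ := Finset.mem_filter.mp hpA
      have hpp := hI p hpI
      rw [hmA p hpA]
      -- `l ∣ e(w ∣ v)`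
      have hbad : f ⟨p, hp⟩ ∈ badPlacesAvoid (ratPoint q) {2, l} := by
        have hpS : ∀ s ∈ ({2, l} : Finset ℕ), ¬ p ∣ s := by
          intro s hs hps
          simp only [Finset.mem_insert, Finset.mem_singleton] at hs
          rcases hs with rfl | rfl
          · exact hp2 ((Nat.prime_dvd_prime_iff_eq hpp Nat.prime_two).mp hps)
          · exact hpl ((Nat.prime_dvd_prime_iff_eq hpp hl).mp hps)
        rw [hf]
        exact primesEquiv_symm_mem_badPlacesAvoid_ratPoint hI he hD hj hN {2, l} hpI (hcop p hpI) hpS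
      have hldvd := ThetaVolumeDatumAt.l_dvd_ramificationIdx'_of_mem_badPlacesAvoid T (f ⟨p, hp⟩) hbad w hw
      -- `lcm(30/gcd(30,e_p), c_p) ∣ e(w ∣ v)`
      have hkF : ∀ x : HeightOneSpectrum (𝓞 T.F), ((p : ℕ) : 𝓞 T.F) ∈ x.asIdeal →
          Nat.lcm (30 / Nat.gcd 30 (e p)) (if p = 3 then 2 else if p = 5 then 4 else 1) ∣
            x.asIdeal.ramificationIdx ℤ := by
        intro x hx
        refine Nat.lcm_dvd (T.div_gcd_thirty_dvd_ramificationIdx_F hI he hD hj hN hpI (hcop p hpI) x hx) ?_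
        by_cases h3 : p = 3
        · rw [if_pos h3]; subst h3
          exact T.sub_one_dvd_ramificationIdx_int (by norm_num) (by norm_num) x hx
        · rw [if_neg h3]
          by_cases h5 : p = 5
          · rw [if_pos h5]; subst h5
            exact T.sub_one_dvd_ramificationIdx_int (by norm_num) (by norm_num) x hx
          · rw [if_neg h5]; exact one_dvd _
      have hkdvd := T.dvd_ramificationIdx'_ratPoint_of_forall hkF (f ⟨p, hp⟩) hmem w hw
      -- `l` is prime to `lcm(…) ∣ 60`
      have hcop60 : Nat.Coprime (Nat.lcm (30 / Nat.gcd 30 (e p)) (if p = 3 then 2 else if p = 5 then 4 else 1)) l := by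
        have h60 : Nat.lcm (30 / Nat.gcd 30 (e p)) (if p = 3 then 2 else if p = 5 then 4 else 1) ∣ 60 := by
          refine Nat.lcm_dvd ((Nat.div_dvd_of_dvd (Nat.gcd_dvd_left 30 (e p))).trans (by norm_num)) ?_
          split_ifs <;> norm_num
        have hc : Nat.Coprime 60 l := by
          have h2 : Nat.Coprime 2 l := (Nat.coprime_primes Nat.prime_two hl).mpr hl2.symm
          have h3 : Nat.Coprime 3 l := (Nat.coprime_primes (by norm_num) hl).mpr hl3.symm
          have h5 : Nat.Coprime 5 l := (Nat.coprime_primes (by norm_num) hl).mpr hl5.symm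
          have : (60 : ℕ) = 2 * 2 * 3 * 5 := by norm_num
          rw [this]
          exact ((h2.mul_left h2).mul_left h3).mul_left h5
        exact Nat.Coprime.coprime_dvd_left h60 hc
      rw [mul_comm]
      exact hcop60.mul_dvd_of_dvd_of_dvd hkdvd hldvd
    · rcases Finset.mem_union.mp hpBC with hpB | hpC
      · rcases Finset.mem_insert.mp hpB with rfl | hpB
        · -- `p = 2`: weight `2` (`√−1 ∈ F`)
          rw [hm2]
          exact T.two_dvd_ramificationIdx'_ratPoint (f ⟨2, hp⟩) hmem w hw
        · -- `p = l`: weight `l − 1` (`μ_l ⊂ K`)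
          rw [Finset.mem_singleton] at hpB
          subst hpB
          rw [hml]
          exact T.sub_one_dvd_ramificationIdx'_ratPoint_l (f ⟨p, hp⟩) hmem w hw
      · -- `p ∈ {3, 5} ∖ I`: weights `2`, `4` (`μ₃₀ ⊂ F`)
        obtain ⟨h35, hnot⟩ := Finset.mem_sdiff.mp hpC
        rcases Finset.mem_insert.mp h35 with rfl | h35
        · rw [hm3 hnot]
          exact T.sub_one_dvd_ramificationIdx'_ratPoint_of_dvd_thirty (by norm_num) (by norm_num) (f ⟨3, hp⟩) hmem w hw
        · rw [Finset.mem_singleton] at h35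
          subst h35
          rw [hm5 hnot]
          exact T.sub_one_dvd_ramificationIdx'_ratPoint_of_dvd_thirty (by norm_num) (by norm_num) (f ⟨5, hp⟩) hmem w hw
  -- the weight sum, read over the primes
  have hsum : ∑ v ∈ S, (1 - (m v : ℝ)⁻¹) * Real.log (absNorm v.asIdeal : ℝ) =
      (∑ p ∈ I.filter (fun p => p ≠ 2 ∧ p ≠ l),
          (1 - ((l * Nat.lcm (30 / Nat.gcd 30 (e p)) (if p = 3 then 2 else if p = 5 then 4 else 1) : ℕ) : ℝ)⁻¹)
            * Real.log p)
        + 2⁻¹ * Real.log 2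
        + (if 3 ∈ I then 0 else 2⁻¹ * Real.log 3)
        + (if 5 ∈ I then 0 else (3 / 4 : ℝ) * Real.log 5)
        + (1 - ((l - 1 : ℕ) : ℝ)⁻¹) * Real.log l := by
    rw [hS, Finset.sum_image fun a _ b _ hab => hfinj hab]
    have h1 : ∑ pp ∈ Ps.attach, (1 - (m (f pp) : ℝ)⁻¹) * Real.log (absNorm (f pp).asIdeal : ℝ) =
        ∑ pp ∈ Ps.attach, (1 - (m' pp.1 : ℝ)⁻¹) * Real.log pp.1 := by
      refine Finset.sum_congr rfl fun pp _ => ?_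
      rw [absNorm_asIdeal_eq_natGenerator (f pp), hm]
      simp only [hgen]
    rw [h1, Finset.sum_attach Ps (fun p => (1 - (m' p : ℝ)⁻¹) * Real.log p), hPs]
    exact sum_sharpWeights_eq h7 m' hmA hm2 hml hm3 hm5
  -- the shell function: `(a_p − p^{a_p}/m_p)·log p` on `Psh`, `0` elsewhere
  letI := T.instIsElliptic
  obtain ⟨Sf, hSf⟩ : ∃ Sf : (p : ℕ) → placesOver (fieldOfModuli T.E) p → ℝ, Sf = fun p _ =>
      if p ∈ Psh then (((a p : ℕ) : ℝ) - (p : ℝ) ^ (a p) /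
        ((l * Nat.lcm (30 / Nat.gcd 30 (e p)) (if p = 3 then 2 else if p = 5 then 4 else 1) : ℕ) : ℝ)) * Real.log p
      else 0 := ⟨_, rfl⟩
  -- every pole of `Psh` is a support prime (its completions are ramified: `e ≥ m_p ≥ l ≥ 7`)
  have hMge : ∀ p ∈ Psh, l ≤ l * Nat.lcm (30 / Nat.gcd 30 (e p)) (if p = 3 then 2 else if p = 5 then 4 else 1) :=
    fun p _ => Nat.le_mul_of_pos_right _ (hlcmpos p)
  have hPshT : ∀ p ∈ Psh, p ∈ T.I.supportPrimes := by
    intro p hpP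
    obtain ⟨hp2, hpl, -⟩ := hPsh p hpP
    have hpI := hPshI hpP
    have hpp := hI p hpI
    haveI : Fact p.Prime := ⟨hpp⟩
    obtain ⟨u, hu⟩ := placesOver_nonempty (fieldOfModuli T.E) p
    have hdvd := T.weight_dvd_ramificationIdx_int_of_mem hl h7 hI he hD hj hN hcop hpI hp2 hpl
      (T.I.σ.lift u) (T.I.σ.natCast_mem_lift ⟨u, hu⟩)
    by_contra hnot
    have hdisc : ¬ (p : ℤ) ∣ NumberField.discr T.K := by
      intro hd
      apply hnot
      refine Finset.mem_union_left _ (Nat.mem_primeFactors.mpr ⟨hpp, ?_, ?_⟩)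
      · exact dvd_mul_of_dvd_right (Int.natCast_dvd.mp hd) 2
      · exact mul_ne_zero two_ne_zero (Int.natAbs_ne_zero.mpr (NumberField.discr_ne_zero T.K))
    have h1 := absRamificationIdx_rescaledCompletion_eq_one_of_not_dvd_discr T.K p (T.I.σ.lift u)
      (T.I.σ.natCast_mem_lift ⟨u, hu⟩) hdisc
    rw [absRamificationIdx_rescaledCompletion] at h1
    rw [h1] at hdvd
    have := Nat.le_of_dvd one_pos hdvd
    have := hMge p hpP
    omega
  -- the shell pairs at every completion
  have hS : ∀ (p : ℕ) [hp : Fact p.Prime] (u : placesOver (fieldOfModuli T.E) p),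
      ∃ c z : (T.I.σ.localFieldFamily p hp.out).k u,
        c ≠ 0 ∧ (∀ o : (T.I.σ.localFieldFamily p hp.out).k u, ‖o‖ ≤ 1 → c * o ∈ logUnits _) ∧
        (∃ (ϖ : ((T.I.σ.localFieldFamily p hp.out).k u)ˣ) (w : (T.I.σ.localFieldFamily p hp.out).k u),
          IsUniformizer ϖ ∧ w ∉ logUnits _ ∧ ‖w‖ * ‖(ϖ : (T.I.σ.localFieldFamily p hp.out).k u)‖ ≤ ‖c‖) ∧
        z ≠ 0 ∧ z ∈ logUnits _ ∧ Sf p u ≤ Real.log ‖z‖ - Real.log ‖c‖ := by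
    intro p hp u
    by_cases hpP : p ∈ Psh
    · obtain ⟨hp2, hpl, hndvd⟩ := hPsh p hpP
      have hpI := hPshI hpP
      have hdvd := T.weight_dvd_ramificationIdx_int_of_mem hl h7 hI he hD hj hN hcop hpI hp2 hpl
        (T.I.σ.lift u.1) (T.I.σ.natCast_mem_lift u)
      rw [← T.I.σ.absRamificationIdx_localFieldFamily_eq u] at hdvd
      have he0 : 0 < absRamificationIdx p ((T.I.σ.localFieldFamily p hp.out).k u) := absRamificationIdx_pos p _
      have hMle := Nat.le_of_dvd he0 hdvd
      have hldvd : l ∣ absRamificationIdx p ((T.I.σ.localFieldFamily p hp.out).k u) := (dvd_mul_right l _).trans hdvd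
      -- not a cyclotomic index
      have hne : ∀ a' : ℕ, (absRamificationIdx p ((T.I.σ.localFieldFamily p hp.out).k u) : ℤ) ≠
          (p : ℤ) ^ a' * ((p : ℤ) - 1) := by
        intro a' hcontra
        have hp1 : 1 ≤ p := hp.out.pos
        have hnat : absRamificationIdx p ((T.I.σ.localFieldFamily p hp.out).k u) = p ^ a' * (p - 1) := by
          have : ((p : ℤ) - 1) = ((p - 1 : ℕ) : ℤ) := by push_cast [Nat.cast_sub hp1]; ring
          rw [this] at hcontra
          exact_mod_cast hcontra
        rw [hnat] at hldvd
        rcases (Nat.Prime.dvd_mul hl).mp hldvd with h1 | h1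
        · exact hpl ((Nat.prime_dvd_prime_iff_eq hl hp.out).mp (hl.dvd_of_dvd_pow h1)).symm
        · exact hndvd h1
      obtain ⟨c, z, hc0, hc, hmax, hz0, hzΛ, hge⟩ :=
        exists_shellPair_ge_of_forall_ne p (K := (T.I.σ.localFieldFamily p hp.out).k u) hne (a p)
      refine ⟨c, z, hc0, hc, hmax, hz0, hzΛ, le_trans ?_ hge⟩
      rw [hSf]
      simp only [if_pos hpP]
      have hlogp : 0 < Real.log p := Real.log_pos (by exact_mod_cast hp.out.one_lt)
      have hMpos : (0 : ℝ) < ((l * Nat.lcm (30 / Nat.gcd 30 (e p)) (if p = 3 then 2 else if p = 5 then 4 else 1) : ℕ) : ℝ) := by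
        exact_mod_cast Nat.mul_pos hl.pos (hlcmpos p)
      have heR : (((l * Nat.lcm (30 / Nat.gcd 30 (e p)) (if p = 3 then 2 else if p = 5 then 4 else 1) : ℕ) : ℝ)) ≤
          (absRamificationIdx p ((T.I.σ.localFieldFamily p hp.out).k u) : ℝ) := by exact_mod_cast hMle
      have hdiv : (p : ℝ) ^ (a p) / (absRamificationIdx p ((T.I.σ.localFieldFamily p hp.out).k u) : ℝ) ≤
          (p : ℝ) ^ (a p) / ((l * Nat.lcm (30 / Nat.gcd 30 (e p)) (if p = 3 then 2 else if p = 5 then 4 else 1) : ℕ) : ℝ) :=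
        div_le_div_of_nonneg_left (by positivity) hMpos heR
      have hinv : (0 : ℝ) ≤ 1 / (absRamificationIdx p ((T.I.σ.localFieldFamily p hp.out).k u) : ℝ) := by positivity
      have hcast : (((a p : ℕ) : ℝ)) = (a p : ℝ) := rfl
      nlinarith [hdiv, hinv, hlogp]
    · obtain ⟨c, z, hc0, hc, hmax, hz0, hzΛ, hnn⟩ := exists_shellPair_nonneg p (K := (T.I.σ.localFieldFamily p hp.out).k u)
      refine ⟨c, z, hc0, hc, hmax, hz0, hzΛ, le_trans ?_ hnn⟩
      rw [hSf]
      simp only [if_neg hpP, le_refl]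
  -- the shell sum, read over `Psh`
  have hshell : ∑ p ∈ T.I.supportPrimes, (((l : ℝ) + 5) / 4) *
        ∑ u : placesOver (fieldOfModuli T.E) p, weight (fieldOfModuli T.E) u.1 * Sf p u =
      ((l : ℝ) + 5) / 4 * ∑ p ∈ Psh,
        (((a p : ℕ) : ℝ) - (p : ℝ) ^ (a p) /
          ((l * Nat.lcm (30 / Nat.gcd 30 (e p)) (if p = 3 then 2 else if p = 5 then 4 else 1) : ℕ) : ℝ)) * Real.log p := by
    rw [← Finset.mul_sum]
    congr 1
    have h1 : ∀ p ∈ T.I.supportPrimes, ∑ u : placesOver (fieldOfModuli T.E) p, weight (fieldOfModuli T.E) u.1 * Sf p u =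
        if p ∈ Psh then (((a p : ℕ) : ℝ) - (p : ℝ) ^ (a p) /
          ((l * Nat.lcm (30 / Nat.gcd 30 (e p)) (if p = 3 then 2 else if p = 5 then 4 else 1) : ℕ) : ℝ)) * Real.log p
        else 0 := by
      intro p hpT
      haveI : Fact p.Prime := ⟨T.I.prime_of_mem_supportPrimes hpT⟩
      rw [hSf]
      by_cases hpP : p ∈ Psh
      · simp only [if_pos hpP]
        rw [← Finset.sum_mul]
        have hw : ∑ u : placesOver (fieldOfModuli T.E) p, weight (fieldOfModuli T.E) u.1 = 1 :=
          (localWeights (fieldOfModuli T.E) p).sum_pr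
        rw [hw, one_mul]
      · simp only [if_neg hpP, mul_zero, Finset.sum_const_zero]
    rw [Finset.sum_congr rfl h1, ← Finset.sum_filter]
    congr 1
    ext p
    simp only [Finset.mem_filter]
    exact ⟨fun h => h.2, fun h => ⟨hPshT p h, h⟩⟩
  refine T.cor312PerImageOf_of_le_weighted_shell hUP.1.1
    (by rw [hd1]; have : (7 : ℝ) ≤ l := by exact_mod_cast h7
        push_cast; linarith) S m hmS hram Sf hS ?_
  have harch : ThetaVolumeInput.archLogTheta l = ((l : ℝ) + 5) / 4 * Real.log Real.pi := rfl
  have hld : (ratPoint q).logDiff = 0 := by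
    rw [NFPoint.logDiff_eq_log_discr]
    change ((Module.finrank ℚ ℚ : ℕ) : ℝ)⁻¹ * Real.log ((NumberField.discr ℚ).natAbs : ℕ) = 0
    rw [Rat.numberField_discr]
    simp
  rw [harch, hd1, hld, degree_ratPoint, hshell]
  push_cast
  simp only [inv_one, one_mul, zero_add]
  convert h using 4
  all_goals first
    | exact hsum
    | (refine Finset.sum_congr rfl fun p _ => ?_; push_cast; ring)

end Literature.IUT.LogVolume.Cor22

end
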